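import Summits.ABC.IUTFork.Thm311Sig
import Literature.IUT.LogVolume.PilotDivisors
import Literature.IUT.LogVolume.FakeAdeleIndex
import Literature.IUT.LogThetaLattice.LocalLogShells
import Mathlib.NumberTheory.NumberField.Completion.InfinitePlace
import Mathlib.RingTheory.DedekindDomain.AdicValuation
import Mathlib.Algebra.CharP.Algebra
import HarnessLib

/-!
# [IUTchIII] Theorem 3.11 over real definitions, A: index skeleton and log-shell carriers INSTANTIATED

Record-only file (D-0012) of the abc-iut cell (Cor. 3.12 sub-crew, wave-2 seat abc-iut-c312-5, board row
W2-A of `HOME/plan/COR312-ASSIGNMENTS.md`); TAKES NO SIDE on [IUTchIII] Cor. 3.12.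
`Thm311Sig.lean` (seat abc-iut-c312-1) types [IUTchIII] Thm. 3.11 over NAMED SIGNATURES `Thm311.ThetaIndex`
([IUTchI] Def. 3.1 index skeleton) and `Thm311.LogShells T` ([IUTchIII] Prop. 1.2 (vi)(vii) mono-analytic
log-shells + the two automorphism families Thm. 3.11 (i) lets act), and DEFINES the tensor packets and
(Ind1), (Ind2) from them. Human ruling D-0060 asks for «Cor 3.12 stated against the real definitions …
every constant resolving to a landed Literature/IUT decl (no local placeholder structures)». This file gives
INSTANCES of both signatures whose every field is a landed Mathlib / `Literature.IUT` term:
* `Real.thetaIndex X` from pilot data `X : Literature.IUT.LogVolume.PilotData F` (Dupuy–Hilado §3.3, seat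
  abc-iut-c312-3): `V := V(F)` (all places), `V_ℚ := V(ℚ)`, `v ↦ v_ℚ` = residue characteristic
  (`residueChar`), `V^bad := S` (`ord_v(j_E) < 0`), `l⋇ := (l−1)/2`; fibres finite/nonempty =
  abc-iut-c312-3's `placesOver` / `placesOver_nonempty` — EXACTLY the index spaces `V(F)_p` of the DH form.
* `Real.logShells X logv Aut Ism …`: carriers `log(D⊢_v) := K_v` (Mathlib `InfinitePlace.Completion` /
  `HeightOneSpectrum.adicCompletion`) as `ℚ`-modules; shells `I_v := (p_v^*)⁻¹·log_v(O_v^×)` at finite `v`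
  (abc-iut-L6-t3's `nonarchLogShell`, [IUTchIII] Rmk. 1.2.2 (i)) over a `p_v`-adic logarithm BINDER
  `logv v : O_v^× → K_v`, and `I_v := {|a| ≤ π}` at infinite `v` (preimage of L6-t3's `arcLogShell` under
  Mathlib's `extensionEmbedding : K_v →+* ℂ`, Rmk. 1.2.2 (ii)).

RESIDUAL LIST of this file (D-0060 ask (3): placeholder → owner · node). The two automorphism families
Thm. 3.11 (i) lets act — `stripAut` (induced by isomorphisms of `D⊢`-prime-strips, i.e. of the topological
group `G_v`, Prop. 1.2 (vi) functoriality / [AbsTopIII] Prop. 5.8 (ii)) and `ism` ("Ism", [IUTchII] Ex. 1.8 (iv);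
the order-2 automorphisms of Prop. 1.2 (vii) at archimedean `v`) — are BINDERS `Aut`, `Ism`, not definitions:
on the concrete carrier `K_v` the automorphisms "induced by isomorphisms of `G_v`" are NOT in general field
automorphisms, and WHICH automorphisms they are is the content of the reconstruction interfaces — defining
them here (e.g. as continuous field automorphisms) would understate (Ind1)/(Ind2) and take a side.
`Aut` → abc-iut-L4-t3 · AbsTopIII:Prop5.8(ii) (`MonoAnalyticLogShells.lean` announced) / abc-iut-L6-t3 ·
IUTchIII:Prop1.2(vi); `Ism` → abc-iut-L6-t1 · IUTchII:Ex1.8(iv) (`RadialExamples.lean` staged) / abc-iut-L6-t3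
· IUTchIII:Prop1.2(vi)(vii); `logv` → abc-iut-S1 · [AbsTopIII] Def. 5.4 (iii) `p`-adic log (TRANCHE-T1 P01).
Everything else resolves to Mathlib + `Literature.IUT.LogVolume` (p403723/p403781/p404008/p404011) +
`Literature.IUT.LogThetaLattice` (p403834, p403825).

MODELLING NOTES. (1) [IUTchI] Def. 3.1 (e) takes `V ⊆ V(K)` a section of `V(K) ↠ V_mod = V(F_mod)`; here, as
in Dupuy–Hilado §3 / `PilotData`, `F` plays `F_mod` and `V := V(F)` (no index set of Thm. 3.11 / Cor. 3.12
changes). `PilotData` does not record Def. 3.1 (a) "`√−1 ∈ F`" (so the text's archimedean `K_v` are COMPLEX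
and `extensionEmbedding` is onto `ℂ`; at a real place of an `F` violating (a) the shell below is `[−π, π] ⊆ ℝ`),
nor (b) "odd residue characteristic" of `V^bad_mod`, nor (c) "`l` prime to" those characteristics and to the
orders of the `q`-parameters, nor (c) "the image of the outer homomorphism `G_F → GL₂(𝔽_l)` determined by the
`l`-torsion points of `E_F` contains the subgroup `SL₂(𝔽_l)`" (p. 62; with the field `K` it determines) —
none of which is a field of `ThetaIndex` (abc-iut-L5-t2's `InitialThetaData` carries all of them; see
`Thm311RealM` for the instance built from it). (2) `log(D⊢_v) := K_v` identifies the mono-analytic container `k~(G_v)` with the field it is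
reconstructed from (tautological isomorphism); the Frobenius-like / étale-like distinction is carried
ENTIRELY by the binders `Aut`, `Ism` — this instance does not model it and does not claim to. (3) Packets,
sub-packets, (Ind1), (Ind2) of the instance are abc-iut-c312-1's definitions applied to it; §4 records,
kernel-checked, that the 1-packet at `p` is `⊕_{v|p} K_v` (DH's `A_{V,p}` up to `⊗_ℚ` vs `⊗_{ℚ_p}`); that the
`(j+1)`-packet IS abc-iut-L6-t4's `MPacketN ℚ` ([IUTchIII] Prop. 3.2) by `rfl` is recorded in a comment
(append-only revision once that module's olean is current on the gate).
Sources read on the page: [IUTchI] pp. 61–62 (Def. 3.1 (b)(c)(d)(e)); [IUTchIII] pp. 32–33 (Prop. 1.2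
(vi)(vii)), 36 (Rmk. 1.2.2 (i)(ii)), 153–154 (Thm. 3.11 (i), (Ind1), (Ind2)); Dupuy–Hilado arXiv:2004.13228
§3.3, §3.6, §4.7. [claim: Mochizuki2012, status: disputed] [cite: DupuyHilado2025, §3.3]
NOT here: `MRData` / `Column` / `LinkData` / `FullSituation` instances (sequel, against c312-1's files B–D
once staged/landed); log-volumes (abc-iut-S2, L6-t4); any judgement. typed ≠ discharged; instantiated ≠ endorsed.
-/

noncomputable section

namespace Summit.ABC.IUTFork.Thm311.Real

open NumberField IsDedekindDomain Literature.IUT.LogVolume Literature.IUT.LogThetaLattice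

/-! ## 1. Places of a number field and of `ℚ` -/

/-- The set `V(F)` of ALL places of the number field `F`: archimedean (`InfinitePlace F`) and
nonarchimedean (`HeightOneSpectrum (𝓞 F)`, the nonzero primes of `𝓞 F`) — [IUTchI] §0 "Numbers":
"`V(F)` … the set of valuations of `F` … `V(F)^arc` … `V(F)^non`". [folklore] -/
abbrev Place (F : Type) [Field F] [NumberField F] : Type :=
  InfinitePlace F ⊕ HeightOneSpectrum (𝓞 F)

/-- The set `V_ℚ = V(ℚ)` of places of `ℚ`: the unique archimedean place and one place per prime number
(Ostrowski; [IUTchI] Def. 3.1 (d): "`V_ℚ` … the set of valuations of `ℚ`"). [folklore] -/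
abbrev RatPlace : Type := Unit ⊕ Nat.Primes

variable {F : Type} [Field F] [NumberField F]

/-- `v ↦ v_ℚ`, the place of `ℚ` lying under `v` ([IUTchIII] Rmk. 3.1.1 (ii): "`v ∈ V` lying over a given
`v_ℚ`"): an archimedean place lies over `∞`, a finite place over its residue characteristic `p_v`
(abc-iut-c312-3's `Literature.IUT.LogVolume.residueChar`, Dupuy–Hilado §2.5.4). [folklore] -/
def Place.under : Place F → RatPlace
  | .inl _ => .inl ()
  | .inr v => .inr ⟨residueChar F v, residueChar_prime F v⟩

/-- `v_ℚ ∈ V^non_ℚ` iff `v_ℚ` is a prime (the other case being `v_ℚ = ∞ ∈ V^arc_ℚ`). [folklore] -/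
def RatPlace.IsNon : RatPlace → Prop
  | .inl _ => False
  | .inr _ => True

/-- A prime is nonarchimedean. [folklore] -/
@[simp] theorem RatPlace.isNon_inr (p : Nat.Primes) : RatPlace.IsNon (.inr p) := trivial

/-- An archimedean place of `F` lies over `∞`. [folklore] -/
@[simp] theorem Place.under_inl (w : InfinitePlace F) : Place.under (.inl w : Place F) = .inl () := rfl

/-- A finite place of `F` lies over its residue characteristic. [folklore] -/
@[simp] theorem Place.under_inr (v : HeightOneSpectrum (𝓞 F)) :
    Place.under (.inr v : Place F) = .inr ⟨residueChar F v, residueChar_prime F v⟩ := rfl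

/-- The fibre of `V(F) → V_ℚ` over `∞` is the set of archimedean places. [folklore] -/
theorem Place.fibre_inl (u : Unit) :
    {x : Place F | x.under = .inl u} = Set.range Sum.inl := by
  ext x; cases x <;> simp

/-- The fibre of `V(F) → V_ℚ` over a prime `p` is abc-iut-c312-3's `V(F)_p = placesOver F p`
(Dupuy–Hilado §3.6), transported along `Sum.inr`. [cite: DupuyHilado2025, §3.6] -/
theorem Place.fibre_inr (p : Nat.Primes) :
    {x : Place F | x.under = .inr p} =
      Sum.inr '' (↑(haveI : Fact (p : ℕ).Prime := ⟨p.2⟩; placesOver F p) : Set (HeightOneSpectrum (𝓞 F))) := by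
  haveI : Fact (p : ℕ).Prime := ⟨p.2⟩
  ext x
  cases x with
  | inl w => simp
  | inr v =>
    simp only [Set.mem_setOf_eq, Place.under_inr, Sum.inr.injEq, Set.mem_image, Finset.mem_coe,
      exists_eq_right, mem_placesOver_iff_residueChar]
    constructor
    · intro h; exact congrArg Subtype.val h
    · intro h; exact Subtype.ext h

/-- Every fibre of `V(F) → V_ℚ` is finite ([IUTchIII] Rmk. 3.9.1 (i): "`{v_1, …, v_{n_{v_ℚ}}}` … the
[distinct!] elements of `V` that lie over `v_ℚ`"): finitely many archimedean places; finitely many primes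
of `𝓞 F` over `p` (Mathlib `primesOver_finite`, via abc-iut-c312-3's `placesOver`). [folklore] -/
theorem Place.fibre_finite (vQ : RatPlace) : Set.Finite {x : Place F | x.under = vQ} := by
  rcases vQ with u | p
  · rw [Place.fibre_inl]; exact Set.finite_range _
  · rw [Place.fibre_inr]; exact (Finset.finite_toSet _).image _

/-- Every fibre of `V(F) → V_ℚ` is nonempty: `F` has an archimedean place, and over every prime `p`
there is a prime of `𝓞 F` (abc-iut-c312-3's `placesOver_nonempty`, from `Σ_{v|p} e_v f_v = [F:ℚ]`).
[folklore] -/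
theorem Place.fibre_nonempty (vQ : RatPlace) : ∃ x : Place F, x.under = vQ := by
  rcases vQ with ⟨⟨⟩⟩ | p
  · obtain ⟨w⟩ := (inferInstance : Nonempty (InfinitePlace F))
    exact ⟨.inl w, rfl⟩
  · haveI : Fact (p : ℕ).Prime := ⟨p.2⟩
    obtain ⟨v, hv⟩ := placesOver_nonempty F p
    refine ⟨.inr v, ?_⟩
    rw [Place.under_inr, Sum.inr.injEq]
    exact Subtype.ext ((mem_placesOver_iff_residueChar v).mp hv)

/-! ## 2. The index skeleton of initial Θ-data, instantiated from pilot data -/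

/-- **`Thm311.ThetaIndex` INSTANTIATED** from the pilot data `X = (F, j_E, S, l)` of Dupuy–Hilado §3.3
(abc-iut-c312-3's `Literature.IUT.LogVolume.PilotData`): `l⋇ := (l−1)/2` ([IUTchI] Def. 3.1 (c) `l ≥ 5`
prime; `l⋇ := (l−1)/2`, [IUTchI] Introduction p. 3 l. 63–64), `V := V(F)`, `V_ℚ := V(ℚ)`, `v ↦ v_ℚ` the
place below, `V^non_ℚ` = the primes,
`V^bad := S ≠ ∅` — a nonempty finite set of NONARCHIMEDEAN places at which `E_F` has bad multiplicative
reduction, `ord_v(j_E) < 0` ([IUTchI] Def. 3.1 (b): "`V^bad_mod ⊆ V_mod` … a nonempty set of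
nonarchimedean valuations … `E_F` has bad [i.e., multiplicative] reduction at the elements of `V^bad`").
Every field is a Mathlib / `Literature.IUT.LogVolume` term; see the module docstring for the one elision
(`F` plays `F_mod`, `V(F)` plays the section `V ≅ V_mod` of Def. 3.1 (e)).
[claim: Mochizuki2012, status: disputed] -/
def thetaIndex (X : PilotData F) : ThetaIndex where
  lstar := X.lstar
  two_le_lstar := X.two_le_lstar
  V := Place F
  VQ := RatPlace
  over := Place.under
  IsNon := RatPlace.IsNon
  fibre_finite := Place.fibre_finite
  fibre_nonempty := Place.fibre_nonempty
  Vbad := Sum.inr '' (X.S : Set (HeightOneSpectrum (𝓞 F)))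
  Vbad_nonempty := by
    obtain ⟨v, hv⟩ := X.S_nonempty
    exact ⟨.inr v, v, hv, rfl⟩
  Vbad_finite := (Finset.finite_toSet _).image _
  Vbad_non := by
    rintro _ ⟨v, _, rfl⟩
    exact RatPlace.isNon_inr _

variable (X : PilotData F)

/-- The instantiated `l = 2l⋇ + 1` IS the prime `l` of the pilot data (abc-iut-c312-3's `PilotData.l_eq`).
[cite: DupuyHilado2025, §3.3] -/
theorem thetaIndex_l : (thetaIndex X).l = X.l := by
  show 2 * X.lstar + 1 = X.l
  exact X.l_eq.symm

/-- The instantiated capsule index set `S^±_{j+1} = {0, …, j}` is `Fin (j+1)` — the index set of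
Dupuy–Hilado's tuples `V(F)_p^{j+1}` (abc-iut-c312-3's `tupleWeights … j : ProbWeights (Fin (j+1) → placesOver F p)`).
[cite: DupuyHilado2025, §3.6] -/
theorem thetaIndex_Caps (j : (thetaIndex X).Label) : (thetaIndex X).Caps j = Fin ((j : ℕ) + 1) := rfl

/-- `v ∈ V^bad` iff `v` is one of the chosen finite places `S` of bad multiplicative reduction.
[cite: DupuyHilado2025, §3.3] -/
theorem mem_thetaIndex_Vbad_iff (x : Place F) :
    x ∈ (thetaIndex X).Vbad ↔ ∃ v ∈ X.S, x = .inr v := by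
  show x ∈ Sum.inr '' (X.S : Set (HeightOneSpectrum (𝓞 F))) ↔ _
  simp only [Set.mem_image, Finset.mem_coe]
  constructor
  · rintro ⟨v, hv, rfl⟩; exact ⟨v, hv, rfl⟩
  · rintro ⟨v, hv, rfl⟩; exact ⟨v, hv, rfl⟩

/-- At every bad place the elliptic curve has bad multiplicative reduction: `ord_v(j_E) < 0`, hence
`ord_v(q_v) = −ord_v(j_E) > 0` ([IUTchI] Def. 3.1 (b); abc-iut-c312-3's `PilotData.ordq_pos`), which is
what makes "`|log(q)| > 0` … easily computed in terms of the various `q`-parameters … at `v ∈ V^bad`"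
in [IUTchIII] Cor. 3.12. [cite: DupuyHilado2025, §3.3] -/
theorem ordq_pos_of_mem_Vbad {x : Place F} (hx : x ∈ (thetaIndex X).Vbad) :
    ∃ v ∈ X.S, x = .inr v ∧ 0 < X.ordq v := by
  obtain ⟨v, hv, rfl⟩ := (mem_thetaIndex_Vbad_iff X x).mp hx
  exact ⟨v, hv, rfl, X.ordq_pos hv⟩

/-- The fibre of the instantiated `V → V_ℚ` over a prime `p` IS Dupuy–Hilado's index probability space
`V(F)_p` (abc-iut-c312-3's `placesOver F p`), as types. [cite: DupuyHilado2025, §3.6] -/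
def fibreEquivPlacesOver (p : Nat.Primes) :
    haveI : Fact (p : ℕ).Prime := ⟨p.2⟩
    (thetaIndex X).Fibre (.inr p) ≃ ↥(placesOver F p) :=
  haveI : Fact (p : ℕ).Prime := ⟨p.2⟩
  { toFun := fun x =>
      match x with
      | ⟨.inr v, h⟩ => ⟨v, (mem_placesOver_iff_residueChar v).mpr
          (congrArg Subtype.val (Sum.inr.inj h))⟩
      | ⟨.inl _, h⟩ => absurd h (by simp [thetaIndex])
    invFun := fun v => ⟨.inr v.1, by
      show Place.under (.inr v.1 : Place F) = .inr p
      rw [Place.under_inr, Sum.inr.injEq]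
      exact Subtype.ext ((mem_placesOver_iff_residueChar v.1).mp v.2)⟩
    left_inv := by
      rintro ⟨x, h⟩
      rcases x with w | v
      · exact absurd h (by simp [thetaIndex])
      · rfl
    right_inv := fun _ => rfl }

/-- The fibre of the instantiated `V → V_ℚ` over `∞` IS the set of archimedean places of `F`. [folklore] -/
def fibreEquivInfinitePlace : (thetaIndex X).Fibre (.inl ()) ≃ InfinitePlace F where
  toFun x :=
    match x with
    | ⟨.inl w, _⟩ => w
    | ⟨.inr _, h⟩ => absurd h (by simp [thetaIndex])
  invFun w := ⟨.inl w, rfl⟩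
  left_inv := by
    rintro ⟨x, h⟩
    rcases x with w | v
    · rfl
    · exact absurd h (by simp [thetaIndex])
  right_inv _ := rfl

/-! ## 3. The log-shell carriers `log(D⊢_v) := K_v` and the shells, instantiated -/

/-- The local field `K_v` at a place `v` of `F`: Mathlib's completion at an archimedean place
(`InfinitePlace.Completion`, `≅ ℝ` or `ℂ`) resp. the `v`-adic completion at a finite place
(`HeightOneSpectrum.adicCompletion`). This is the carrier `log(D⊢_v)` ("`k~(G_v)`", [IUTchIII] Prop. 1.2
(vi), (vii)) of the instance, see the module docstring's modelling note. [folklore] -/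
def Carrier : Place F → Type
  | .inl w => w.Completion
  | .inr v => v.adicCompletion F

/-- `K_v` is a complete normed field (Mathlib: `InfinitePlace.Completion` with its absolute value; the
`v`-adic completion with the norm `|·|_v` of `instNormedFieldValuedAdicCompletion`). [folklore] -/
instance instNormedFieldCarrier : ∀ x : Place F, NormedField (Carrier x)
  | .inl w => inferInstanceAs (NormedField w.Completion)
  | .inr v => inferInstanceAs (NormedField (v.adicCompletion F))

/-- `K_v` is an `F`-algebra. [folklore] -/
instance instAlgebraCarrier : ∀ x : Place F, Algebra F (Carrier x)
  | .inl w => inferInstanceAs (Algebra F w.Completion)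
  | .inr v => inferInstanceAs (Algebra F (v.adicCompletion F))

/-- `K_v` has characteristic `0` (it contains `F`). [folklore] -/
instance instCharZeroCarrier (x : Place F) : CharZero (Carrier x) :=
  charZero_of_injective_algebraMap (algebraMap F (Carrier x)).injective

/-- The ring of integers `O_v ⊆ K_v` at a finite place (Mathlib `adicCompletionIntegers`), as a valuation
subring — the `O_k` of [IUTchIII] Rmk. 1.2.2 (i). [folklore] -/
abbrev integers (v : HeightOneSpectrum (𝓞 F)) : ValuationSubring (Carrier (.inr v : Place F)) :=
  v.adicCompletionIntegers F

/-- The type of a family of `p_v`-ADIC LOGARITHMS on units, one per finite place: abstract homomorphisms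
`log_v : O_v^× → (K_v, +)` — exactly the datum abc-iut-L6-t3's `nonarchLogShell` is typed over
([IUTchIII] Def. 1.1 (i) "`log_k`"; the analytic `p`-adic logarithm with `log(1 + p^*O) = p^*O` is campaign-S
infrastructure, seat abc-iut-S1 — RESIDUAL, see the module docstring). A Π-type, not a structure.
[folklore] -/
abbrev PadicLogs (F : Type) [Field F] [NumberField F] : Type :=
  ∀ v : HeightOneSpectrum (𝓞 F), Additive (↥(integers (F := F) v))ˣ →+ Carrier (.inr v : Place F)

/-- The LOG-SHELL `I_v ⊆ K_v` at each place: at a finite `v`, `I_v := (p_v^*)⁻¹ · log_v(O_v^×)`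
(abc-iut-L6-t3's `nonarchLogShell`, [IUTchIII] Rmk. 1.2.2 (i) p. 36, with `p_v` = `residueChar F v`); at
an archimedean `v`, `I_v := {a ∈ K_v | |a| ≤ π}` = the preimage of abc-iut-L6-t3's `arcLogShell ⊆ ℂ` under
Mathlib's `extensionEmbedding : K_v →+* ℂ` ([IUTchIII] Rmk. 1.2.2 (ii) p. 36).
[claim: Mochizuki2012, status: disputed] -/
def shell (logv : PadicLogs F) : ∀ x : Place F, Set (Carrier x)
  | .inl w => (InfinitePlace.Completion.extensionEmbedding w) ⁻¹' arcLogShell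
  | .inr v => nonarchLogShell (integers v) (logv v) (residueChar F v)

/-- At an archimedean place the instantiated shell is the closed ball of radius `π` of `K_v`
(`extensionEmbedding` is an isometry) — [IUTchIII] Rmk. 1.2.2 (ii) "`I_k := {a ∈ k | |a| ≤ π}`".
[claim: Mochizuki2012, status: disputed] -/
theorem shell_inl (logv : PadicLogs F) (w : InfinitePlace F) :
    shell logv (.inl w) = {a : Carrier (.inl w : Place F) | ‖a‖ ≤ Real.pi} := by
  ext a
  show InfinitePlace.Completion.extensionEmbedding w a ∈ arcLogShell ↔ ‖a‖ ≤ Real.pi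
  rw [arcLogShell, Set.mem_setOf_eq,
    (InfinitePlace.Completion.isometry_extensionEmbedding w).norm_map_of_map_zero (map_zero _)]
  exact Iff.rfl

/-- At a finite place the instantiated shell is `(p_v^*)⁻¹ · log_v(O_v^×)` by definition. [claim: Mochizuki2012, status: disputed] -/
theorem shell_inr (logv : PadicLogs F) (v : HeightOneSpectrum (𝓞 F)) :
    shell logv (.inr v) = nonarchLogShell (integers v) (logv v) (residueChar F v) := rfl

/-- (c^non) for the instance: `log_v(O_v^×) ⊆ I_v` at every finite place — abc-iut-L6-t3's
`log_mem_nonarchLogShell`, the hypothesis `p_v^* ≠ 0` in `K_v` being automatic in characteristic `0`.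
[claim: Mochizuki2012, status: disputed] -/
theorem log_mem_shell (logv : PadicLogs F) (v : HeightOneSpectrum (𝓞 F)) (x : (↥(integers v))ˣ) :
    logv v (Additive.ofMul x) ∈ shell logv (.inr v) := by
  rw [shell_inr]
  refine log_mem_nonarchLogShell (integers v) (logv v) (residueChar F v) ?_ x
  exact Nat.cast_ne_zero.mpr (pStar_ne_zero (residueChar_prime F v).ne_zero)

/-- **`Thm311.LogShells` INSTANTIATED** over `Real.thetaIndex X`: carriers `log(D⊢_v) := K_v` (as
`ℚ`-modules), shells `I_v` as in `Real.shell`; the two automorphism families of [IUTchIII] Thm. 3.11 (i)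
— `stripAut` (induced by isomorphisms of `D⊢`-prime-strips, Prop. 1.2 (vi) functoriality) and `ism`
("Ism", Prop. 1.2 (vi) / [IUTchII] Ex. 1.8 (iv); the order-2 automorphisms of Prop. 1.2 (vii) at
archimedean `v`) — are the BINDERS `Aut`, `Ism` (sets of `ℚ`-linear automorphisms of each `K_v` containing
the identity): they are the residual mono-analytic content, see the module docstring. From this instance
abc-iut-c312-1's `LogShells.Packet`, `.SubPacket`, `.Ind1`, `.Ind2` are the tensor packets and the
indeterminacies (Ind1), (Ind2) of Theorem 3.11 (i) ON `⊗_{i ≤ j} ⊕_{v | v_ℚ} K_v`.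
[claim: Mochizuki2012, status: disputed] -/
def logShells (X : PilotData F) (logv : PadicLogs F)
    (Aut Ism : ∀ x : Place F, Set (Carrier x ≃ₗ[ℚ] Carrier x))
    (hAut : ∀ x, LinearEquiv.refl ℚ (Carrier x) ∈ Aut x)
    (hIsm : ∀ x, LinearEquiv.refl ℚ (Carrier x) ∈ Ism x) :
    LogShells (thetaIndex X) where
  carrier := Carrier
  shell := shell logv
  stripAut := Aut
  ism := Ism
  one_mem_stripAut := hAut
  one_mem_ism := hIsm

variable (logv : PadicLogs F) (Aut Ism : ∀ x : Place F, Set (Carrier x ≃ₗ[ℚ] Carrier x))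
  (hAut : ∀ x, LinearEquiv.refl ℚ (Carrier x) ∈ Aut x)
  (hIsm : ∀ x, LinearEquiv.refl ℚ (Carrier x) ∈ Ism x)

/-! ## 4. The tensor packets of the instance (kernel-checked dictionary entries) -/

/-- The 1-TENSOR PACKET of the instance at `v_ℚ`, `log(D⊢_{v_ℚ}) = ⊕_{v | v_ℚ} K_v` (abc-iut-c312-1's
`LogShells.Packet1` applied; [IUTchIII] Prop. 3.2 first display), unfolds to the product of the `K_v` over
the fibre. [claim: Mochizuki2012, status: disputed] -/
theorem packet1_eq (vQ : RatPlace) :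
    (logShells X logv Aut Ism hAut hIsm).Packet1 vQ = (∀ v : (thetaIndex X).Fibre vQ, Carrier v.1) := rfl

/-- At a prime `p` the 1-tensor packet of the instance is, `ℚ`-linearly, `⊕_{v ∈ V(F)_p} K_v` indexed by
abc-iut-c312-3's `placesOver F p` — Dupuy–Hilado's `A_{V,p} = ⊕_{v|p} K_v` (§4.7, up to `⊗_ℚ` vs `⊗_{ℚ_p}`
as recorded in `Thm311Sig`). [cite: DupuyHilado2025, §4.7] -/
def packet1EquivPi (p : Nat.Primes) :
    haveI : Fact (p : ℕ).Prime := ⟨p.2⟩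
    (logShells X logv Aut Ism hAut hIsm).Packet1 (.inr p) ≃ₗ[ℚ]
      (∀ v : ↥(placesOver F p), Carrier (.inr v.1 : Place F)) :=
  haveI : Fact (p : ℕ).Prime := ⟨p.2⟩
  { toFun := fun f v => f ((fibreEquivPlacesOver X p).symm v)
    invFun := fun g x => by
      have hx := x.2
      obtain ⟨y, hy⟩ := x
      rcases y with w | v
      · exact absurd hy (by simp [thetaIndex])
      · exact g ⟨v, (mem_placesOver_iff_residueChar v).mpr
          (congrArg Subtype.val (Sum.inr.inj hy))⟩
    map_add' := fun _ _ => rfl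
    map_smul' := fun _ _ => rfl
    left_inv := by
      intro f
      funext x
      obtain ⟨y, hy⟩ := x
      rcases y with w | v
      · exact absurd hy (by simp [thetaIndex])
      · rfl
    right_inv := fun _ => rfl }

/- DICTIONARY entry deferred to an append-only revision (gate olean lag on `TensorPackets` at filing
time): `(logShells …).Packet j vQ = Literature.IUT.LogThetaLattice.MPacketN ℚ (fun _ v => Carrier v.1)`
holds by `rfl` (farm-checked 2026-08-25T18:58Z; abc-iut-c312-1's `Thm311Dictionary` records the same
identity for the signature). -/

/-- NON-VACUITY of the instantiated index skeleton: `V^bad` is inhabited (by the pilot data's `S ≠ ∅`),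
so the `q`-pilot side of Cor. 3.12 has at least one bad place to sum over. [folklore] -/
theorem thetaIndex_Vbad_nonempty : (thetaIndex X).Vbad.Nonempty := (thetaIndex X).Vbad_nonempty

/-- NON-VACUITY of (Ind1)/(Ind2) for the instance in the weak sense (inhabited by the identity —
abc-iut-c312-1's `refl_mem_Ind1`); whether they move anything is a property of the binders `Aut`, `Ism`.
[folklore] -/
theorem refl_mem_Ind1_real (j : (thetaIndex X).Label) :
    (fun vQ => LinearEquiv.refl ℚ ((logShells X logv Aut Ism hAut hIsm).Packet j vQ)) ∈
      (logShells X logv Aut Ism hAut hIsm).Ind1 j :=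
  (logShells X logv Aut Ism hAut hIsm).refl_mem_Ind1 j

end Summit.ABC.IUTFork.Thm311.Real

end
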